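import Mathlib.Analysis.SpecialFunctions.Complex.Log
import Literature.NumberTheory.Transcendental.GammaFields
import HarnessLib

/-!
# The ω-chain of a free ELA-closure of `SK` inside `ℂ` (Kirby 2013 FPEF, §2): definitions

J. Kirby, *Finitely presented exponential fields*, Algebra & Number Theory 7 (2013), §2, constructs
for a partial exponential field `F` with full kernel a *free ELA-closure* `F^{ELA}`
(Construction 2.13: the union of a chain `F ↪ F^e ↪ F^{el} ↪ F^{ela} ↪ ⋯` obtained by freely
adjoining exponentials (Construction 2.6: images algebraically independent, with coherent systems of
roots), logarithms (Construction 2.13: fresh transcendental logarithms) and taking algebraic closures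
(Construction 2.9)), all "inside a large algebraically closed field `𝒞`"; the extensions are strong
(Lemma 2.14) and kernel-preserving ("Any partial E-field `F` with full kernel can be extended to an
ELA-field without adding new kernel elements", before Construction 2.13). Applied to Zilber's base
`SK` (Construction 2.11: `D(SK) = ℚτ`, `exp(τ/m)` a coherent system of primitive roots of unity,
`τ` transcendental) it produces countable ELA-fields with standard kernel and the Schanuel property.

This file sets up that construction with `𝒞 = ℂ`, one element at a time along an enumeration, in
the form used by the tree's proof of the existence of countable pseudo-exponential fields:

* the ambient data `PseudoExpChain.AmbientData`: a countable algebraically closed subfield `Ω ⊆ ℂ`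
  containing `2πi`, `acl`-closed, with room (such exist: `PseudoExpAmbient.exists_ambient`), which
  will be the underlying field of the model;
* states `PseudoExpChain.PState A`: a finite set `s ⊆ Ω` of basis vectors of the current domain
  `D = span_ℚ s` and an assignment `w : Ω → ℂ` of *logarithms*; the partial exponential is
  `x ↦ cexp (Λ x)` for the `ℚ`-linear `Λ : Ω → ℂ` with `Λ v = w v` on `s` (`PState.Λ`) — the choice
  of a linear `Λ` through prescribed complex logarithms is this file's device for Kirby's "coherent
  system of roots" (`exp (x/m) = cexp (Λ x / m)`), and the base `τ = 2πi`, `w τ = 2πi` gives `SK`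
  with its standard kernel (`cexp` on `ℚ · 2πi`);
* the three steps `stepExp a` (Construction 2.6 for one element: `exp a :=` a fresh transcendental
  `t ∈ Ω`), `stepLog b` (Construction 2.13 for one element: a fresh transcendental `a` with
  `exp a := b`), `stepGen` (a fresh exponentially transcendental pair), and the chain
  `PseudoExpChain.chain A : ℕ → PState A` along a fixed enumeration of the tasks;
* the basic invariants: monotonicity, linear independence of `s`, `cexp (w v) ∈ Ω`, `τ ∈ s` with
  `w τ = 2πi`, compatibility of the `Λ`'s, every element of `Ω` eventually in the domain, and the
  resulting total map `PseudoExpChain.Λ∞` with the exponential ring structure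
  `PseudoExpChain.instExponentialRing` on `↥Ω`, `exp x = cexp (Λ∞ x)`.

The axioms of the resulting exponential field (ELA, kernel `2πi ℤ`, Schanuel property, infinite
dimension) are proved in `PseudoExpChainAxioms.lean`.

## References

* J. Kirby, *Finitely presented exponential fields*, Algebra & Number Theory 7 (2013) 943–980,
  arXiv:0912.4019: Def. 2.1, Constructions 2.6, 2.9, 2.11, 2.13, Lemma 2.14.
* B. Zilber, *Pseudo-exponentiation on algebraically closed fields of characteristic zero*,
  Ann. Pure Appl. Logic 132 (2005) 67–95, §1.
-/

noncomputable section

open Set Complex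
open scoped ComplexConjugate

namespace Literature.NumberTheory.Transcendental

namespace PseudoExpChain

open GammaField

/-! ### Linear algebra: linear maps through prescribed values on an independent set -/

/-- A `ℚ`-linear map with prescribed values on a linearly independent set. [folklore] -/
theorem exists_linearMap_of_linearIndepOn {V W : Type*} [AddCommGroup V] [Module ℚ V]
    [AddCommGroup W] [Module ℚ W] {s : Set V} (hs : LinearIndepOn ℚ _root_.id s) (f : V → W) :
    ∃ Λ : V →ₗ[ℚ] W, ∀ v ∈ s, Λ v = f v := by
  classical
  refine ⟨(Module.Basis.extend hs).constr ℚ (fun x => f x), fun v hv => ?_⟩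
  have hmem : v ∈ hs.extend (Set.subset_univ _) := hs.subset_extend _ hv
  have h := Module.Basis.constr_basis (Module.Basis.extend hs) ℚ (fun x => f x) ⟨v, hmem⟩
  rw [Module.Basis.extend_apply_self] at h
  exact h

/-! ### The ambient data -/

/-- **Ambient data** for the construction: a countable algebraically closed subfield `Ω ⊆ ℂ`
containing `2πi`, closed under `acl` in `ℂ`, with room in `ℂ` (such `Ω` exist:
`PseudoExpAmbient.exists_ambient`, recorded as `AmbientData.nonempty` in `PseudoExpChainAxioms.lean`).
Kirby's "large algebraically closed field `𝒞`" is `ℂ`; `Ω` will be the underlying field of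
`SK^{ELA}`.
[cite: Kirby2013FPEF, Construction 2.6 ("embed F in a large algebraically closed field 𝒞")] -/
structure AmbientData where
  /-- the underlying field -/
  Ω : Subfield ℂ
  /-- `Ω` is countable -/
  countable : Countable Ω
  /-- `Ω` is algebraically closed -/
  isAlgClosed : IsAlgClosed Ω
  /-- `2πi ∈ Ω` -/
  twoPiI_mem : (2 * Real.pi * Complex.I : ℂ) ∈ Ω
  /-- `Ω` is `acl`-closed in `ℂ` -/
  acl_subset : ∀ x : ℂ, x ∈ acl (Ω : Set ℂ) → x ∈ Ω
  /-- room in `ℂ`: no finite subset of `ℂ` spans `Ω` -/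
  room : ∀ S : Set ℂ, S.Finite → ∃ t ∈ Ω, t ∉ acl S

namespace AmbientData

variable (A : AmbientData)

/-- Instance recorded for the construction. [folklore] -/
instance : Countable A.Ω := A.countable

/-- Instance recorded for the construction. [folklore] -/
instance : IsAlgClosed A.Ω := A.isAlgClosed

/-- The kernel generator `τ = 2πi ∈ Ω`. [cite: Kirby2013FPEF, Construction 2.11 (SK)] -/
def τ : A.Ω := ⟨2 * Real.pi * Complex.I, A.twoPiI_mem⟩

/-- The underlying complex number of `τ` is `2πi`. [folklore] -/
@[simp] theorem coe_τ : (A.τ : ℂ) = 2 * Real.pi * Complex.I := rfl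

/-- `τ ≠ 0`. [folklore] -/
theorem τ_ne_zero : A.τ ≠ 0 := by
  intro h
  have : (2 * Real.pi * Complex.I : ℂ) = 0 := by rw [← coe_τ, h]; rfl
  have hpi : (Real.pi : ℂ) ≠ 0 := Complex.ofReal_ne_zero.2 Real.pi_ne_zero
  exact (mul_ne_zero (mul_ne_zero two_ne_zero hpi) Complex.I_ne_zero) this

/-- A fresh element of `Ω` outside `acl S`, for `S ⊆ ℂ` finite (chosen). [folklore] -/
def fresh (S : Set ℂ) (hS : S.Finite) : A.Ω :=
  ⟨Classical.choose (A.room S hS), (Classical.choose_spec (A.room S hS)).1⟩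

/-- The fresh element avoids `acl S`. [folklore] -/
theorem fresh_notMem (S : Set ℂ) (hS : S.Finite) : (A.fresh S hS : ℂ) ∉ acl S :=
  (Classical.choose_spec (A.room S hS)).2

/-- The fresh element is non-zero (`0` is algebraic). [folklore] -/
theorem fresh_ne_zero (S : Set ℂ) (hS : S.Finite) : (A.fresh S hS : ℂ) ≠ 0 := fun h =>
  A.fresh_notMem S hS (h ▸ zero_mem_acl S)

/-- Elements of `ℂ` algebraic over a subset of `Ω` lie in `Ω`. [folklore] -/
theorem mem_of_mem_acl {S : Set ℂ} (hS : S ⊆ A.Ω) {x : ℂ} (hx : x ∈ acl S) : x ∈ A.Ω :=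
  A.acl_subset x (acl_mono hS hx)

end AmbientData

/-! ### States -/

variable (A : AmbientData)

/-- A **state** of the construction: the finite set `s` of basis vectors of the domain
`D = span_ℚ s` of the partial exponential map, and the logarithms `w` (only the values on `s`
matter). Kirby's partial E-field (Def. 2.1) is `(Ω, D, x ↦ cexp (Λ x))`.
[cite: Kirby2013FPEF, Def. 2.1 and Construction 2.4] -/
structure PState where
  /-- basis vectors of the domain -/
  s : Finset A.Ω
  /-- logarithms of the basis vectors -/
  w : A.Ω → ℂ

variable {A}

namespace PState

/-- The domain `D = span_ℚ s`. [cite: Kirby2013FPEF, Def. 2.1 (D(F))] -/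
def D (σ : PState A) : Submodule ℚ A.Ω := Submodule.span ℚ (σ.s : Set A.Ω)

/-- `s ⊆ D`. [folklore] -/
theorem subset_D (σ : PState A) : (σ.s : Set A.Ω) ⊆ σ.D := Submodule.subset_span

/-- The finite set of complex numbers generating the current partial E-field up to algebraic
closure: the basis vectors and the exponentials of their logarithms. [folklore] -/
def genℂ (σ : PState A) : Set ℂ :=
  ((↑) : A.Ω → ℂ) '' (σ.s : Set A.Ω) ∪ (fun v => cexp (σ.w v)) '' (σ.s : Set A.Ω)

/-- `genℂ` is finite. [folklore] -/
theorem genℂ_finite (σ : PState A) : σ.genℂ.Finite :=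
  ((σ.s.finite_toSet).image _).union ((σ.s.finite_toSet).image _)

/-- Basis vectors belong to `genℂ`. [folklore] -/
theorem coe_mem_genℂ (σ : PState A) {v : A.Ω} (hv : v ∈ σ.s) : (v : ℂ) ∈ σ.genℂ :=
  Or.inl ⟨v, hv, rfl⟩

/-- Exponentials of the logarithms belong to `genℂ`. [folklore] -/
theorem cexp_mem_genℂ (σ : PState A) {v : A.Ω} (hv : v ∈ σ.s) : cexp (σ.w v) ∈ σ.genℂ :=
  Or.inr ⟨v, hv, rfl⟩

/-- A state is **good** if its basis vectors are linearly independent; then the logarithms extend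
to a linear map. [folklore] -/
def Good (σ : PState A) : Prop := LinearIndepOn ℚ _root_.id (σ.s : Set A.Ω)

/-- The linear map `Λ : Ω → ℂ` through the logarithms (`Λ v = w v` for `v ∈ s`) when the state is
good, and `0` otherwise (chosen). [cite: Kirby2013FPEF, Construction 2.4] -/
def Λ (σ : PState A) : A.Ω →ₗ[ℚ] ℂ := by
  classical
  exact if h : σ.Good then Classical.choose (exists_linearMap_of_linearIndepOn h σ.w) else 0

/-- `Λ v = w v` on the basis vectors of a good state. [folklore] -/
theorem Λ_apply_of_mem {σ : PState A} (h : σ.Good) {v : A.Ω} (hv : v ∈ σ.s) : σ.Λ v = σ.w v := by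
  classical
  rw [Λ, dif_pos h]
  exact Classical.choose_spec (exists_linearMap_of_linearIndepOn h σ.w) v hv

/-- Two linear maps agreeing with `w` on `s` agree on `D`. [folklore] -/
theorem linearMap_eqOn_D {σ : PState A} {f g : A.Ω →ₗ[ℚ] ℂ} (hf : ∀ v ∈ σ.s, f v = σ.w v)
    (hg : ∀ v ∈ σ.s, g v = σ.w v) {x : A.Ω} (hx : x ∈ σ.D) : f x = g x := by
  have : Set.EqOn f g (σ.s : Set A.Ω) := fun v hv => (hf v hv).trans (hg v hv).symm
  exact LinearMap.eqOn_span this hx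

/-- The partial exponential `x ↦ cexp (Λ x)` of a state (as a complex number).
[cite: Kirby2013FPEF, Construction 2.4] -/
def E (σ : PState A) (x : A.Ω) : ℂ := cexp (σ.Λ x)

/-- The partial exponential is a homomorphism. [folklore] -/
theorem E_add (σ : PState A) (x y : A.Ω) : σ.E (x + y) = σ.E x * σ.E y := by
  simp [E, map_add, Complex.exp_add]

/-- `E 0 = 1`. [folklore] -/
theorem E_zero (σ : PState A) : σ.E 0 = 1 := by simp [E]

/-- `E x ≠ 0`. [folklore] -/
theorem E_ne_zero (σ : PState A) (x : A.Ω) : σ.E x ≠ 0 := Complex.exp_ne_zero _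

/-- `E v = cexp (w v)` on basis vectors. [folklore] -/
theorem E_of_mem {σ : PState A} (h : σ.Good) {v : A.Ω} (hv : v ∈ σ.s) : σ.E v = cexp (σ.w v) := by
  rw [E, Λ_apply_of_mem h hv]

/-- Adjoining one new basis vector `a ∉ D` with logarithm `ω`. [folklore] -/
def adjoin (σ : PState A) (a : A.Ω) (ω : ℂ) : PState A :=
  ⟨insert a σ.s, Function.update σ.w a ω⟩

/-- The basis vectors after `adjoin`. [folklore] -/
@[simp] theorem adjoin_s (σ : PState A) (a : A.Ω) (ω : ℂ) : (σ.adjoin a ω).s = insert a σ.s := rfl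

/-- The new logarithm after `adjoin`. [folklore] -/
theorem adjoin_w_self (σ : PState A) (a : A.Ω) (ω : ℂ) : (σ.adjoin a ω).w a = ω := by
  simp [adjoin]

/-- Old logarithms are kept by `adjoin`. [folklore] -/
theorem adjoin_w_of_ne (σ : PState A) {a v : A.Ω} (ω : ℂ) (h : v ≠ a) : (σ.adjoin a ω).w v = σ.w v := by
  simp [adjoin, Function.update_of_ne h]

/-- The domain after `adjoin` is `D + ℚa`. [folklore] -/
theorem adjoin_D (σ : PState A) (a : A.Ω) (ω : ℂ) :
    (σ.adjoin a ω).D = σ.D ⊔ Submodule.span ℚ {a} := by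
  rw [D, adjoin_s, Finset.coe_insert, Submodule.span_insert, sup_comm, D]

/-- `adjoin` preserves linear independence when `a ∉ D`. [folklore] -/
theorem good_adjoin {σ : PState A} (h : σ.Good) {a : A.Ω} (ha : a ∉ σ.D) (ω : ℂ) :
    (σ.adjoin a ω).Good := by
  change LinearIndepOn ℚ _root_.id (↑(insert a σ.s) : Set A.Ω)
  rw [Finset.coe_insert]
  exact h.id_insert ha

/-! ### The three steps -/

/-- **Adjoining an exponential** (Kirby, Construction 2.6, one basis element at a time): if `a ∉ D`,
set `exp a := t` for a fresh `t ∈ Ω` transcendental over everything so far and over `a`, with the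
coherent system of roots `exp (a/m) := cexp ((log t)/m)`. [cite: Kirby2013FPEF, Construction 2.6] -/
def stepExp (a : A.Ω) (σ : PState A) : PState A := by
  classical
  exact if a ∈ σ.D then σ
    else σ.adjoin a (Complex.log (A.fresh (σ.genℂ ∪ {(a : ℂ)}) (σ.genℂ_finite.union (finite_singleton _))))

/-- **Adjoining a logarithm** (Kirby, Construction 2.13, one element at a time): if `b ≠ 0` has no
logarithm yet, adjoin a fresh transcendental `a` with `exp a := b`, `exp (a/m) := cexp ((log b)/m)`.
[cite: Kirby2013FPEF, Construction 2.13] -/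
def stepLog (b : A.Ω) (σ : PState A) : PState A := by
  classical
  exact if b = 0 ∨ ∃ x ∈ σ.D, σ.E x = b then σ
    else σ.adjoin (A.fresh (σ.genℂ ∪ {(b : ℂ)}) (σ.genℂ_finite.union (finite_singleton _))) (Complex.log b)

/-- **Adjoining an exponentially transcendental element**: a fresh `a` with a fresh transcendental
`exp a := t` (Construction 2.6 applied to a new field generator; this makes the result infinite
dimensional). [cite: Kirby2013FPEF, Construction 2.6] -/
def stepGen (σ : PState A) : PState A :=
  let a : A.Ω := A.fresh σ.genℂ σ.genℂ_finite
  σ.adjoin a (Complex.log (A.fresh (σ.genℂ ∪ {(a : ℂ)}) (σ.genℂ_finite.union (finite_singleton _))))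

/-! ### Invariants of one step -/

/-- The invariant carried along the chain: the state is good, `τ ∈ s` with `w τ = 2πi`, and the
exponentials of the logarithms lie in `Ω`. [folklore] -/
structure Inv (σ : PState A) : Prop where
  good : σ.Good
  τ_mem : A.τ ∈ σ.s
  w_τ : σ.w A.τ = 2 * Real.pi * Complex.I
  cexp_mem : ∀ v ∈ σ.s, cexp (σ.w v) ∈ A.Ω

/-- Elements of `D` are algebraic over `genℂ` (they are `ℚ`-combinations of `s`). [folklore] -/
theorem coe_mem_acl_genℂ (σ : PState A) {x : A.Ω} (hx : x ∈ σ.D) : (x : ℂ) ∈ acl σ.genℂ := by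
  induction hx using Submodule.span_induction with
  | mem v hv => exact subset_acl _ (σ.coe_mem_genℂ hv)
  | zero => exact zero_mem_acl _
  | add x y _ _ hx hy =>
    have : ((x + y : A.Ω) : ℂ) = (x : ℂ) + y := rfl
    rw [this]
    exact add_mem_acl hx hy
  | smul q x _ hx =>
    have : ((q • x : A.Ω) : ℂ) = q • (x : ℂ) := by
      rw [Rat.smul_def, Rat.smul_def]
      push_cast
      rfl
    rw [this]
    exact smul_mem_acl q hx

/-- A fresh element over `genℂ` is not in `D` (elements of `D` are algebraic over `genℂ`).
[folklore] -/
theorem fresh_notMem_D (σ : PState A) {S : Set ℂ} (hS : S.Finite) (hgen : σ.genℂ ⊆ S) :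
    A.fresh S hS ∉ σ.D := fun h =>
  A.fresh_notMem S hS (acl_mono hgen (σ.coe_mem_acl_genℂ h))

/-- `adjoin` preserves the invariant when `a ∉ D`, `a ≠ τ`… more precisely when `a ∉ s` is new and
`cexp ω ∈ Ω`. [folklore] -/
theorem Inv.adjoin {σ : PState A} (h : σ.Inv) {a : A.Ω} (ha : a ∉ σ.D) {ω : ℂ} (hω : cexp ω ∈ A.Ω) :
    (σ.adjoin a ω).Inv where
  good := good_adjoin h.good ha ω
  τ_mem := by rw [adjoin_s]; exact Finset.mem_insert_of_mem h.τ_mem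
  w_τ := by
    have hne : A.τ ≠ a := fun heq => ha (heq ▸ σ.subset_D h.τ_mem)
    rw [adjoin_w_of_ne σ ω hne, h.w_τ]
  cexp_mem := by
    intro v hv
    rw [adjoin_s, Finset.mem_insert] at hv
    by_cases hva : v = a
    · subst hva; rwa [adjoin_w_self]
    · rw [adjoin_w_of_ne σ ω hva]
      rcases hv with rfl | hv
      · exact (hva rfl).elim
      · exact h.cexp_mem v hv

/-- The exponential step preserves the invariant. [folklore] -/
theorem Inv.stepExp {σ : PState A} (h : σ.Inv) (a : A.Ω) : (σ.stepExp a).Inv := by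
  classical
  unfold PState.stepExp
  split_ifs with ha
  · exact h
  · refine h.adjoin ha ?_
    rw [Complex.exp_log (A.fresh_ne_zero _ _)]
    exact (A.fresh _ _).2

/-- The logarithm step preserves the invariant. [folklore] -/
theorem Inv.stepLog {σ : PState A} (h : σ.Inv) (b : A.Ω) : (σ.stepLog b).Inv := by
  classical
  unfold PState.stepLog
  split_ifs with hb
  · exact h
  · push Not at hb
    refine h.adjoin (σ.fresh_notMem_D _ subset_union_left) ?_
    have hb0 : (b : ℂ) ≠ 0 := fun h0 => hb.1 (Subtype.ext h0)
    rw [Complex.exp_log hb0]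
    exact b.2

/-- The generic step preserves the invariant. [folklore] -/
theorem Inv.stepGen {σ : PState A} (h : σ.Inv) : σ.stepGen.Inv := by
  refine h.adjoin (σ.fresh_notMem_D _ le_rfl) ?_
  rw [Complex.exp_log (A.fresh_ne_zero _ _)]
  exact (A.fresh _ _).2

/-! Monotonicity of one step: the old basis vectors are kept, with their logarithms. -/

/-- `σ ≼ σ'`: `s ⊆ s'` and the logarithms agree on `s`. [folklore] -/
def LE (σ σ' : PState A) : Prop := σ.s ⊆ σ'.s ∧ ∀ v ∈ σ.s, σ'.w v = σ.w v

/-- `≼` is reflexive. [folklore] -/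
theorem LE.refl (σ : PState A) : σ.LE σ := ⟨Finset.Subset.refl _, fun _ _ => rfl⟩

/-- `≼` is transitive. [folklore] -/
theorem LE.trans {σ₁ σ₂ σ₃ : PState A} (h₁ : σ₁.LE σ₂) (h₂ : σ₂.LE σ₃) : σ₁.LE σ₃ :=
  ⟨h₁.1.trans h₂.1, fun v hv => (h₂.2 v (h₁.1 hv)).trans (h₁.2 v hv)⟩

/-- Domains grow along `≼`. [folklore] -/
theorem LE.D_le {σ σ' : PState A} (h : σ.LE σ') : σ.D ≤ σ'.D :=
  Submodule.span_mono (by exact_mod_cast h.1)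

/-- `σ ≼ σ.adjoin a ω` for a new `a`. [folklore] -/
theorem le_adjoin (σ : PState A) {a : A.Ω} (ha : a ∉ σ.s) (ω : ℂ) : σ.LE (σ.adjoin a ω) :=
  ⟨by rw [adjoin_s]; exact Finset.subset_insert _ _,
    fun v hv => adjoin_w_of_ne σ ω (fun h => ha (h ▸ hv))⟩

/-- The exponential step extends the state. [folklore] -/
theorem le_stepExp (σ : PState A) (a : A.Ω) : σ.LE (σ.stepExp a) := by
  classical
  unfold PState.stepExp
  split_ifs with ha
  · exact LE.refl σ
  · exact σ.le_adjoin (fun h => ha (σ.subset_D h)) _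

/-- The logarithm step extends the state. [folklore] -/
theorem le_stepLog (σ : PState A) (b : A.Ω) : σ.LE (σ.stepLog b) := by
  classical
  unfold PState.stepLog
  split_ifs with hb
  · exact LE.refl σ
  · exact σ.le_adjoin (fun h => σ.fresh_notMem_D _ subset_union_left (σ.subset_D h)) _

/-- The generic step extends the state. [folklore] -/
theorem le_stepGen (σ : PState A) : σ.LE σ.stepGen :=
  σ.le_adjoin (fun h => σ.fresh_notMem_D _ le_rfl (σ.subset_D h)) _

/-- Along `≼`, the linear maps agree on the smaller domain. [folklore] -/
theorem LE.Λ_eq {σ σ' : PState A} (h : σ.LE σ') (hσ : σ.Good) (hσ' : σ'.Good) {x : A.Ω}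
    (hx : x ∈ σ.D) : σ'.Λ x = σ.Λ x :=
  linearMap_eqOn_D (fun v hv => (Λ_apply_of_mem hσ' (h.1 hv)).trans (h.2 v hv))
    (fun _ hv => Λ_apply_of_mem hσ hv) hx

/-- Along `≼`, the partial exponentials agree on the smaller domain. [folklore] -/
theorem LE.E_eq {σ σ' : PState A} (h : σ.LE σ') (hσ : σ.Good) (hσ' : σ'.Good) {x : A.Ω}
    (hx : x ∈ σ.D) : σ'.E x = σ.E x := by
  rw [E, E, h.Λ_eq hσ hσ' hx]

end PState

/-! ### Tasks and the chain -/

/-- The tasks: adjoin an exponential of `a`, a logarithm of `b`, or a fresh exponentially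
transcendental element (indexed by `ℕ` so that this happens infinitely often). [folklore] -/
abbrev Task (A : AmbientData) : Type := A.Ω ⊕ A.Ω ⊕ ℕ

/-- A fixed enumeration of all tasks (each task occurs; the `ℕ`-indexed ones are pairwise distinct,
so fresh generic elements are adjoined at infinitely many stages). [folklore] -/
def task (A : AmbientData) : ℕ → Task A :=
  Classical.choose (exists_surjective_nat (Task A))

/-- Every task occurs in the enumeration. [folklore] -/
theorem task_surjective (A : AmbientData) : Function.Surjective (task A) :=
  Classical.choose_spec (exists_surjective_nat (Task A))

/-- One step of the chain, according to the task. [folklore] -/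
def step (t : Task A) (σ : PState A) : PState A :=
  Sum.elim (fun a => σ.stepExp a) (Sum.elim (fun b => σ.stepLog b) (fun _ => σ.stepGen)) t

/-- The initial state: Zilber's base `SK`, `D = ℚ · 2πi` with `exp` the restriction of `cexp`
(`w (2πi) = 2πi`). [cite: Kirby2013FPEF, Construction 2.11 (SK)] -/
def init (A : AmbientData) : PState A := ⟨{A.τ}, fun _ => 2 * Real.pi * Complex.I⟩

variable (A) in
/-- **The ω-chain** `SK = σ₀ ≼ σ₁ ≼ σ₂ ≼ ⋯` of partial exponential structures on `Ω`.
[cite: Kirby2013FPEF, Construction 2.13 (the chain F ↪ F^e ↪ F^{el} ↪ ⋯)] -/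
def chain : ℕ → PState A
  | 0 => init A
  | k + 1 => step (task A k) (chain k)

/-- Unfolding the successor stage of the chain. [folklore] -/
theorem chain_succ (k : ℕ) : chain A (k + 1) = step (task A k) (chain A k) := rfl

/-- The initial state `SK` satisfies the invariant (`cexp (2πi) = 1`). [folklore] -/
theorem inv_init : (init A).Inv where
  good := by
    change LinearIndepOn ℚ _root_.id (({A.τ} : Finset A.Ω) : Set A.Ω)
    rw [Finset.coe_singleton]
    exact (linearIndepOn_singleton_iff ℚ).2 A.τ_ne_zero
  τ_mem := Finset.mem_singleton_self _
  w_τ := rfl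
  cexp_mem := by
    intro _ _
    change cexp (2 * Real.pi * Complex.I) ∈ A.Ω
    rw [Complex.exp_two_pi_mul_I]
    exact one_mem _

/-- Each step preserves the invariant. [folklore] -/
theorem inv_step {σ : PState A} (h : σ.Inv) (t : Task A) : (step t σ).Inv := by
  rcases t with a | b | j
  · exact h.stepExp a
  · exact h.stepLog b
  · exact h.stepGen

/-- Each step extends the state. [folklore] -/
theorem le_step (σ : PState A) (t : Task A) : σ.LE (step t σ) := by
  rcases t with a | b | j
  · exact σ.le_stepExp a
  · exact σ.le_stepLog b
  · exact σ.le_stepGen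

/-- **The invariant holds along the chain.** [folklore] -/
theorem inv_chain : ∀ k, (chain A k).Inv
  | 0 => inv_init
  | k + 1 => inv_step (inv_chain k) _

/-- The stages are good. [folklore] -/
theorem good_chain (k : ℕ) : (chain A k).Good := (inv_chain k).good

/-- **The chain is increasing.** [folklore] -/
theorem chain_le_succ (k : ℕ) : (chain A k).LE (chain A (k + 1)) := le_step _ _

/-- The chain is increasing (transitive closure). [folklore] -/
theorem chain_mono {k l : ℕ} (h : k ≤ l) : (chain A k).LE (chain A l) := by
  induction h with
  | refl => exact PState.LE.refl _
  | step _ ih => exact ih.trans (chain_le_succ _)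

/-- The domains increase along the chain. [folklore] -/
theorem D_mono {k l : ℕ} (h : k ≤ l) : (chain A k).D ≤ (chain A l).D := (chain_mono h).D_le

/-- Along the chain the partial exponentials are compatible. [folklore] -/
theorem E_chain_eq {k l : ℕ} (h : k ≤ l) {x : A.Ω} (hx : x ∈ (chain A k).D) :
    (chain A l).E x = (chain A k).E x :=
  (chain_mono h).E_eq (good_chain k) (good_chain l) hx

/-- `τ` is in every domain, with `Λ τ = 2πi`. [folklore] -/
theorem τ_mem_D (k : ℕ) : A.τ ∈ (chain A k).D := (chain A k).subset_D (inv_chain k).τ_mem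

/-- `Λₖ τ = 2πi` at every stage. [folklore] -/
theorem Λ_τ (k : ℕ) : (chain A k).Λ A.τ = 2 * Real.pi * Complex.I := by
  rw [PState.Λ_apply_of_mem (good_chain k) (inv_chain k).τ_mem, (inv_chain k).w_τ]

/-- **Every element of `Ω` is eventually in the domain** (its exponential task occurs).
[cite: Kirby2013FPEF, Construction 2.7 (F^E is total)] -/
theorem exists_mem_D (a : A.Ω) : ∃ k, a ∈ (chain A k).D := by
  classical
  obtain ⟨k, hk⟩ := task_surjective A (Sum.inl a)
  refine ⟨k + 1, ?_⟩
  rw [chain_succ, hk]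
  change a ∈ ((chain A k).stepExp a).D
  unfold PState.stepExp
  split_ifs with ha
  · exact ha
  · rw [PState.adjoin_D]
    exact Submodule.mem_sup_right (Submodule.mem_span_singleton_self a)

/-! ### The total exponential -/

/-- The first stage at which `a` is in the domain. [folklore] -/
def stage (a : A.Ω) : ℕ := by
  classical
  exact Nat.find (exists_mem_D a)

/-- `a` lies in the domain at its stage. [folklore] -/
theorem mem_D_stage (a : A.Ω) : a ∈ (chain A (stage a)).D := by
  classical
  exact Nat.find_spec (exists_mem_D a)

/-- **The total exponential as a complex number**: `Einf a = cexp (Λₖ a)` for any stage `k` whose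
domain contains `a`. [cite: Kirby2013FPEF, Construction 2.13 (F^{ELA} = ⋃ of the chain)] -/
def Einf (a : A.Ω) : ℂ := (chain A (stage a)).E a

/-- `Einf` is computed in any stage whose domain contains the element. [folklore] -/
theorem Einf_eq {k : ℕ} {a : A.Ω} (ha : a ∈ (chain A k).D) : Einf a = (chain A k).E a := by
  rw [Einf]
  rcases le_total (stage a) k with h | h
  · exact (E_chain_eq h (mem_D_stage a)).symm
  · exact E_chain_eq h ha

/-- `Einf` is a homomorphism. [folklore] -/
theorem Einf_add (a b : A.Ω) : Einf (a + b) = Einf a * Einf b := by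
  obtain ⟨k, hk⟩ := exists_mem_D a
  obtain ⟨l, hl⟩ := exists_mem_D b
  have ha : a ∈ (chain A (max k l)).D := D_mono (le_max_left k l) hk
  have hb : b ∈ (chain A (max k l)).D := D_mono (le_max_right k l) hl
  rw [Einf_eq (Submodule.add_mem _ ha hb), Einf_eq ha, Einf_eq hb, PState.E_add]

/-- `Einf 0 = 1`. [folklore] -/
theorem Einf_zero : Einf (0 : A.Ω) = 1 := by
  rw [Einf_eq (Submodule.zero_mem (chain A 0).D), PState.E_zero]

/-- Exponentials of rational multiples stay algebraic: `cexp (q • z) ∈ acl {cexp z}`. [folklore] -/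
theorem cexp_smul_mem_acl (q : ℚ) (z : ℂ) : cexp (q • z) ∈ acl ({cexp z} : Set ℂ) := by
  refine mem_acl_of_pow_mem q.den_nz ?_
  have : cexp (q • z) ^ q.den = cexp z ^ q.num := by
    rw [← Complex.exp_nat_mul, ← Complex.exp_int_mul]
    congr 1
    rw [Rat.smul_def, ← mul_assoc]
    congr 1
    have h := Rat.mul_den_eq_num q
    have h' : ((q.den : ℚ) * q : ℂ) = (q.num : ℂ) := by rw [mul_comm]; exact_mod_cast h
    push_cast at h' ⊢
    exact h'
  rw [this]
  exact zpow_mem_acl (subset_acl _ (mem_singleton _)) _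

/-- **The exponentials lie in `Ω`**: for `x ∈ Dₖ`, `cexp (Λₖ x) ∈ Ω` (products of rational powers
of the `cexp (w v)`, which lie in `Ω`, and `Ω` is `acl`-closed). [folklore] -/
theorem E_mem_Ω {σ : PState A} (h : σ.Inv) {x : A.Ω} (hx : x ∈ σ.D) : σ.E x ∈ A.Ω := by
  induction hx using Submodule.span_induction with
  | mem v hv => rw [PState.E_of_mem h.good hv]; exact h.cexp_mem v hv
  | zero => rw [PState.E_zero]; exact one_mem _
  | add x y _ _ hx hy => rw [PState.E_add]; exact mul_mem hx hy
  | smul q x _ hx =>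
    rw [PState.E, map_smul]
    refine A.mem_of_mem_acl (S := {cexp (σ.Λ x)}) (by simpa [PState.E] using hx) ?_
    exact cexp_smul_mem_acl q _

/-- `Einf` takes values in `Ω`. [folklore] -/
theorem Einf_mem (a : A.Ω) : Einf a ∈ A.Ω :=
  E_mem_Ω (inv_chain _) (mem_D_stage a)

variable (A) in
/-- **The exponential ring structure of `SK^{ELA}` on `Ω`**: `exp a = cexp (Λ∞ a)`.
[cite: Kirby2013FPEF, Construction 2.13] -/
instance instExponentialRing : Literature.ModelTheory.ExponentialFields.ExponentialRing A.Ω where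
  exp a := ⟨Einf a, Einf_mem a⟩
  exp_zero := Subtype.ext Einf_zero
  exp_add a b := Subtype.ext (Einf_add a b)

/-- The exponential of `(Ω, exp)` as a complex number is `Einf`. [folklore] -/
theorem coe_exp (a : A.Ω) :
    ((Literature.ModelTheory.ExponentialFields.ExponentialRing.exp a : A.Ω) : ℂ) = Einf a := rfl

end PseudoExpChain

end Literature.NumberTheory.Transcendental
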